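import Summits.Ventures.PercRepro.C041BlockMapFourCores
import Summits.Ventures.PercRepro.C041TriDomMonotoneInjection

/-!
# ROW C-041 — THE SECOND OPEN CORE IN THE KERNEL: `K₂,₃` plus the chord between the two unmarked vertices satisfies
CONJECTURE (STOCHASTIC DOMINATION) (p6, gen 48; P6-TWOEXIT-LEAN.md §53 ADDENDUM 22 cont. 6)

`k23c` = `K₂,₃` with the marks `0, 1, 2` on the three-side, the unmarked pair `3, 4`, the six edges `x–u, x–v, y–u,
y–v, z–u, z–v` and the chord `u–v` (`T = 20`, `A = (4, 4, 4)`) — with `k23` (`C041TriDomK23Instance`) the only hosts on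
`≤ 5` vertices that THEOREM (ONE MARK EDGE) and the reductions of ADDENDA 16–19 leave open.  The twelve crossed
colourings are decided (`cycCrossed_k23c`, `128` decides in `≤ 4` steps), the red-ward injection `φ23c` into `(⊤,⊥)`
is exhibited, and `cycDomination_iff_injection` gives `cycDomination_k23c`: CONJECTURE (STOCHASTIC DOMINATION) holds
on every host on at most five vertices (with the landed reductions).
-/

namespace PercRepro

namespace ZoneZ

namespace MultiExit

open ZoneData Pendant Finset

/-- A colouring of seven edges is the vector of its values. -/
theorem fin7_eta_k23c (ω : Fin 7 → Bool) : ω = ![ω 0, ω 1, ω 2, ω 3, ω 4, ω 5, ω 6] := by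
  funext i
  fin_cases i <;> rfl

/-- `K₂,₃` plus the chord `3–4`: the edges `0–3, 0–4, 1–3, 1–4, 2–3, 2–4, 3–4`. -/
def k23c : ZoneData (Fin 5) (Fin 7) Empty Empty where
  fst := ![0, 0, 1, 1, 2, 2, 3]
  snd := ![3, 4, 3, 4, 3, 4, 4]
  at₁ := Empty.elim
  at₂ := Empty.elim

set_option synthInstance.maxSize 400000 in
set_option synthInstance.maxHeartbeats 400000 in
set_option maxHeartbeats 16000000 in
/-- **The crossed colourings of `K₂,₃ + uv`**: exactly twelve (four in each cyclic class). -/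
theorem cycCrossed_k23c (b : Fin 7 → Bool) : CycCrossed k23c 0 1 2 b ↔
    b = ![true, false, true, true, false, false, false] ∨
    b = ![false, true, true, true, false, false, false] ∨
    b = ![true, true, false, false, true, false, false] ∨
    b = ![true, true, false, false, false, true, false] ∨
    b = ![false, false, true, false, true, true, false] ∨
    b = ![false, false, false, true, true, true, false] ∨
    b = ![true, false, true, true, false, false, true] ∨
    b = ![false, true, true, true, false, false, true] ∨
    b = ![true, true, false, false, true, false, true] ∨
    b = ![true, true, false, false, false, true, true] ∨
    b = ![false, false, true, false, true, true, true] ∨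
    b = ![false, false, false, true, true, true, true] := by
  unfold CycCrossed
  simp only [rsig, bsig, RdS_free, MgS_free, Prod.mk.injEq, decide_eq_true_eq, decide_eq_false_iff_not,
    Rd_iff_conn k23c (k := 4) (by simp), Mg_iff_conn k23c (k := 4) (by simp)]
  rw [fin7_eta_k23c b]
  generalize b 0 = b₀
  generalize b 1 = b₁
  generalize b 2 = b₂
  generalize b 3 = b₃
  generalize b 4 = b₄
  generalize b 5 = b₅
  generalize b 6 = b₆
  simp only [Conn]
  unfold cAdj ZoneData.Joins
  cases b₀ <;> cases b₁ <;> cases b₂ <;> cases b₃ <;> cases b₄ <;> cases b₅ <;> cases b₆ <;> decide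

set_option synthInstance.maxSize 400000 in
set_option synthInstance.maxHeartbeats 400000 in
set_option maxHeartbeats 16000000 in
/-- The twelve images of the injection lie in `(⊤,⊥)`. -/
theorem topBot_k23c_img :
    TopBot k23c 0 1 2 ![true, true, true, true, true, true, false] ∧
    TopBot k23c 0 1 2 ![true, true, true, true, true, false, false] ∧
    TopBot k23c 0 1 2 ![true, true, true, false, true, true, false] ∧
    TopBot k23c 0 1 2 ![true, true, true, true, false, true, false] ∧
    TopBot k23c 0 1 2 ![true, false, true, true, true, true, false] ∧
    TopBot k23c 0 1 2 ![true, true, false, true, true, true, false] ∧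
    TopBot k23c 0 1 2 ![true, true, true, true, true, false, true] ∧
    TopBot k23c 0 1 2 ![false, true, true, true, true, false, true] ∧
    TopBot k23c 0 1 2 ![true, true, false, true, true, false, true] ∧
    TopBot k23c 0 1 2 ![true, true, true, false, false, true, true] ∧
    TopBot k23c 0 1 2 ![false, true, true, false, true, true, true] ∧
    TopBot k23c 0 1 2 ![true, false, false, true, true, true, true] := by
  unfold TopBot
  simp only [rsig, bsig, RdS_free, MgS_free, Prod.mk.injEq, decide_eq_true_eq, decide_eq_false_iff_not,
    Rd_iff_conn k23c (k := 4) (by simp), Mg_iff_conn k23c (k := 4) (by simp)]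
  simp only [Conn]
  unfold cAdj ZoneData.Joins
  decide

/-- The red-ward injection of the twelve crossed colourings into `(⊤,⊥)`. -/
def φ23c (b : Fin 7 → Bool) : Fin 7 → Bool :=
  if b = ![true, false, true, true, false, false, false] then ![true, true, true, true, true, true, false]
  else if b = ![false, true, true, true, false, false, false] then ![true, true, true, true, true, false, false]
  else if b = ![true, true, false, false, true, false, false] then ![true, true, true, false, true, true, false]
  else if b = ![true, true, false, false, false, true, false] then ![true, true, true, true, false, true, false]
  else if b = ![false, false, true, false, true, true, false] then ![true, false, true, true, true, true, false]
  else if b = ![false, false, false, true, true, true, false] then ![true, true, false, true, true, true, false]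
  else if b = ![true, false, true, true, false, false, true] then ![true, true, true, true, true, false, true]
  else if b = ![false, true, true, true, false, false, true] then ![false, true, true, true, true, false, true]
  else if b = ![true, true, false, false, true, false, true] then ![true, true, false, true, true, false, true]
  else if b = ![true, true, false, false, false, true, true] then ![true, true, true, false, false, true, true]
  else if b = ![false, false, true, false, true, true, true] then ![false, true, true, false, true, true, true]
  else if b = ![false, false, false, true, true, true, true] then ![true, false, false, true, true, true, true]
  else b

/-- The twelve crossed colourings, as a list. -/
def crossed23c : List (Fin 7 → Bool) :=
  [![true, false, true, true, false, false, false],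
    ![false, true, true, true, false, false, false],
    ![true, true, false, false, true, false, false],
    ![true, true, false, false, false, true, false],
    ![false, false, true, false, true, true, false],
    ![false, false, false, true, true, true, false],
    ![true, false, true, true, false, false, true],
    ![false, true, true, true, false, false, true],
    ![true, true, false, false, true, false, true],
    ![true, true, false, false, false, true, true],
    ![false, false, true, false, true, true, true],
    ![false, false, false, true, true, true, true]]

set_option maxRecDepth 40000 in
/-- The injection is injective on the crossed colourings. -/
theorem φ23c_inj : ∀ ω ∈ crossed23c, ∀ ω' ∈ crossed23c, φ23c ω = φ23c ω' → ω = ω' := by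
  decide

set_option maxRecDepth 40000 in
/-- The injection only turns blue edges red. -/
theorem φ23c_le : ∀ ω ∈ crossed23c, LeCol ω (φ23c ω) := by
  unfold LeCol
  decide

set_option maxRecDepth 40000 in
/-- The images of the twelve crossed colourings. -/
theorem φ23c_vals :
    φ23c ![true, false, true, true, false, false, false] = ![true, true, true, true, true, true, false] ∧
    φ23c ![false, true, true, true, false, false, false] = ![true, true, true, true, true, false, false] ∧
    φ23c ![true, true, false, false, true, false, false] = ![true, true, true, false, true, true, false] ∧
    φ23c ![true, true, false, false, false, true, false] = ![true, true, true, true, false, true, false] ∧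
    φ23c ![false, false, true, false, true, true, false] = ![true, false, true, true, true, true, false] ∧
    φ23c ![false, false, false, true, true, true, false] = ![true, true, false, true, true, true, false] ∧
    φ23c ![true, false, true, true, false, false, true] = ![true, true, true, true, true, false, true] ∧
    φ23c ![false, true, true, true, false, false, true] = ![false, true, true, true, true, false, true] ∧
    φ23c ![true, true, false, false, true, false, true] = ![true, true, false, true, true, false, true] ∧
    φ23c ![true, true, false, false, false, true, true] = ![true, true, true, false, false, true, true] ∧
    φ23c ![false, false, true, false, true, true, true] = ![false, true, true, false, true, true, true] ∧
    φ23c ![false, false, false, true, true, true, true] = ![true, false, false, true, true, true, true] := by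
  decide

/-- A crossed colouring is in the list. -/
theorem mem_crossed23c {b : Fin 7 → Bool} (h : CycCrossed k23c 0 1 2 b) : b ∈ crossed23c := by
  rw [cycCrossed_k23c] at h
  simp only [crossed23c, List.mem_cons, List.mem_nil_iff, or_false]
  exact h

open Classical in
/-- **THEOREM (`K₂,₃ + uv` SATISFIES THE CONJECTURE)**: on every up-set of colourings of `K₂,₃` with the chord
between the unmarked vertices, the cyclic crossed classes are outnumbered by `(⊤,⊥)`. -/
theorem cycDomination_k23c : CycDomination k23c 0 1 2 := by
  rw [cycDomination_iff_injection]
  refine ⟨φ23c, ?_, ?_⟩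
  · intro ω hω ω' hω' heq
    exact φ23c_inj ω (mem_crossed23c hω) ω' (mem_crossed23c hω') heq
  · intro ω hω
    refine ⟨?_, φ23c_le ω (mem_crossed23c hω)⟩
    rw [cycCrossed_k23c] at hω
    obtain ⟨h1, h2, h3, h4, h5, h6, h7, h8, h9, h10, h11, h12⟩ := topBot_k23c_img
    obtain ⟨v1, v2, v3, v4, v5, v6, v7, v8, v9, v10, v11, v12⟩ := φ23c_vals
    rcases hω with rfl | rfl | rfl | rfl | rfl | rfl | rfl | rfl | rfl | rfl | rfl | rfl
    · rw [v1]; exact h1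
    · rw [v2]; exact h2
    · rw [v3]; exact h3
    · rw [v4]; exact h4
    · rw [v5]; exact h5
    · rw [v6]; exact h6
    · rw [v7]; exact h7
    · rw [v8]; exact h8
    · rw [v9]; exact h9
    · rw [v10]; exact h10
    · rw [v11]; exact h11
    · rw [v12]; exact h12

end MultiExit

end ZoneZ

end PercRepro
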